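import Literature.NumberTheory.GaloisRepresentations.LabelledHodgeFiltration
import Literature.NumberTheory.GaloisRepresentations.LabelledWeightsTwist
import Literature.NumberTheory.PAdicHodge.TateGradedFiltration
import Mathlib.LinearAlgebra.Matrix.Determinant.Basic
import Mathlib.RingTheory.TensorProduct.Free
import HarnessLib

/-!
# The filtration of the twisted period ring `B ⊗_{F,τ} E` and the determinant of a labelled period matrix

For a period-ring datum `𝔅` of `Γ` over `F/P` (period ring `B`, `B^Γ = F`, decreasing multiplicative
filtration `Fil^• B`), a coefficient field `E ⊇ P` and a `P`-embedding `τ : F → E`, the accepted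
`PeriodRingData.TwistRing 𝔅 τ = B ⊗_{F,τ} E` is a nonzero commutative ring receiving the coordinate map
`piTwist τ : Eⁿ ⊗_P B → (B ⊗_{F,τ} E)ⁿ`, `v ⊗ b ↦ (b ⊗ v_i)_i` (accepted), which kills the components
`D_{τ'}`, `τ' ≠ τ`, of `D(ρ) = (Eⁿ ⊗_P B)^Γ` and is `B`- and `E`-semilinear.  This file PROVES (no
definition, no named fact, no `sorry`), writing `Fil^i(B ⊗_{F,τ} E)` for the image of
`Fil^i B ⊗_F E` (the range of `(Fil^i B ↪ B) ⊗ id`, an `F`-submodule):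

* `tmul_mem_twistFil`, `twistFil_induction`, `twistFil_antitone`, `mul_mem_twistFil`,
  `one_mem_twistFil_zero`, `prod_mem_twistFil`, `det_mem_twistFil` — **`Fil^•(B ⊗_{F,τ} E)` is a
  decreasing multiplicative filtration**; a determinant whose `l`-th column lies in `Fil^{i_l}` lies in
  `Fil^{Σ i_l}`;
* `one_not_mem_twistFil_one` — **`1 ∉ Fil¹(B ⊗_{F,τ} E)`** (coordinates in a `B`-basis `1 ⊗ β_i` and the
  accepted `E ∩ Fil¹ B = 0`, `TateGraded.eq_zero_of_algebraMap_mem_fil_one`);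
* `piTwist_apply_mem_twistFil` — `piTwist τ` maps `Eⁿ ⊗ Fil^j B` into `(Fil^j(B ⊗_{F,τ} E))ⁿ`;
* `comm_mem_filTensor_of_mem_coeffFilTensor`, `comm_symm_mem_coeffFilTensor_of_mem_filTensor` — the
  dictionary between `M ⊗ Fil^i B` (coefficient side) and `Fil^i B ⊗ M` (Fontaine's side);
* `piTwist_eq_sum_smul_of_mem_coeffFilTensor` — **labelled filtered generation.**  Assume the FILTERED
  COMPARISON for the underlying `P`-linear representation (a `B`-basis `(𝒷_l)` of `B ⊗_P Eⁿ` inside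
  `D_B`, weights `w_l`, with `y ∈ Fil^j(B ⊗ Eⁿ) ↔ coord_l(y) ∈ Fil^{j − w_l} B` — the conclusion of the
  accepted `TateGraded.exists_basis_mem_filTensor_iff`, resp. `exists_basis_mem_filTensor_iff_of_isDeRham`
  for `B_dR`), that `E` contains the `[F:P]` embeddings of `F`, and let `(d_k)` be an `E`-basis of
  `D_τ(ρ)` adapted to the Hodge filtration with weights `h_k` (accepted `exists_basis_labelD_adapted`).
  Then for every `x ∈ Eⁿ ⊗ Fil^j B`:
  **`piTwist τ x = Σ_k A_k · piTwist τ d_k` with `A_k ∈ Fil^{j − h_k}(B ⊗_{F,τ} E)`.**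
  (Write `x = Σ_l c_l 𝒷_l` with `c_l ∈ Fil^{j−w_l} B`; split `𝒷_l = Σ_{τ'} 𝒷_{l,τ'}` along the labels
  with `𝒷_{l,τ} ∈ Fil^{w_l} D_τ` (accepted `exists_sum_labelFilD_eq`); expand `𝒷_{l,τ} = Σ_k e_{lk} d_k`,
  where `e_{lk} ≠ 0 ⇒ w_l ≤ h_k` by adaptedness; apply `piTwist τ`, which kills the other labels:
  `A_k = Σ_l c_l ⊗ e_{lk}`.)
* `isUnit_det_piTwist_and_mem` — **the labelled period determinant.**  If moreover `(d_k)_{k<n}` has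
  `n` members, the `n × n` matrix `C = (piTwist τ d_k)_k` over `B ⊗_{F,τ} E` has
  **`det C` a unit, `det C ∈ Fil^{h}` and `det C ∉ Fil^{h+1}`, `h = Σ_k h_k`**: the standard vectors
  `e_i ⊗ 1 ∈ Eⁿ ⊗ Fil⁰ B` give `A C = 1` with `col_k(A) ⊆ Fil^{−h_k}`, so `det A ∈ Fil^{−h}`,
  `det A · det C = 1`, and `det C ∈ Fil^{h+1}` would put `1 ∈ Fil¹`.

This is the filtered-degree half of `HT_τ(det ρ) = {Σ HT_τ(ρ)}` (Patrikis 2019, §2.3.1: `D_dR` with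
coefficients is a `⊗`-functor of filtered `F ⊗ E`-modules, so `e_τ D_dR(det V) = det_E e_τ D_dR(V)` as
filtered lines); the Galois-equivariance half and the assembly are carried out in the sequel.

## References
* [Patrikis2019] S. Patrikis, *Variations on a theorem of Tate*, Mem. AMS 258 (2019), §2.3.1, §2.7.1.
* [Wach1996] N. Wach, Bull. SMF 124 (1996), §B.2.3, proof of Prop. 2 (p. 394) (filtered comparison in an
  adapted basis).
* [FontaineAsterisque223III] J.-M. Fontaine, Astérisque 223 (1994), Exp. III §1.5.4, Thm. 1.5.2,
  Prop. 1.5.2.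
* [Lang1965Algebra] S. Lang, *Algebra*, Ch. XIII §4 (determinants: multiplicativity, Leibniz formula),
  Ch. XVI (tensor products of algebras, bases of `A ⊗ M`).
-/

noncomputable section

open scoped TensorProduct
open TensorProduct

namespace Literature.NumberTheory.GaloisRepresentations

namespace PeriodRingData

universe u v v' w w'

-- Mathlib's own global value of `maxSynthPendingDepth` (see `LabelledWeightsTwist`).
set_option maxSynthPendingDepth 3

/-! ### The filtration `Fil^i(B ⊗_{F,τ} E) = Fil^i B ⊗_F E` -/

section TwistFil

variable {Γ : Type u} [Group Γ] {P : Type v} {F : Type v'} [Field P] [Field F] [Algebra P F]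
  {E : Type w} [Field E] [Algebra P E] (𝔅 : PeriodRingData.{u, v, v', w'} Γ P F) (τ : F →ₐ[P] E)

/-- `b ⊗ e ∈ Fil^i(B ⊗_{F,τ} E)` for `b ∈ Fil^i B`. [cite: FontaineAsterisque223III, Exp. III §1.5.4] -/
theorem tmul_mem_twistFil {i : ℤ} {b : 𝔅.B} (hb : b ∈ 𝔅.fil i) (e : TwistCoeff τ) :
    b ⊗ₜ[F] e ∈ LinearMap.range ((𝔅.fil i).subtype.rTensor (TwistCoeff τ)) :=
  ⟨⟨b, hb⟩ ⊗ₜ[F] e, by rw [LinearMap.rTensor_tmul]; rfl⟩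

/-- Induction principle for `Fil^i(B ⊗_{F,τ} E)`: it is additively generated by the `b ⊗ e`,
`b ∈ Fil^i B`. [cite: Lang1965Algebra, Ch. XVI §2 (generators of a tensor product)] -/
theorem twistFil_induction {i : ℤ} {C : 𝔅.TwistRing τ → Prop} (h0 : C 0)
    (htmul : ∀ b ∈ 𝔅.fil i, ∀ e : TwistCoeff τ, C (b ⊗ₜ[F] e)) (hadd : ∀ x y, C x → C y → C (x + y))
    {x : 𝔅.TwistRing τ} (hx : x ∈ LinearMap.range ((𝔅.fil i).subtype.rTensor (TwistCoeff τ))) :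
    C x := by
  obtain ⟨t, rfl⟩ := hx
  induction t using TensorProduct.induction_on with
  | zero => rw [map_zero]; exact h0
  | tmul b e => rw [LinearMap.rTensor_tmul]; exact htmul b b.2 e
  | add s t hs ht => rw [map_add]; exact hadd _ _ hs ht

/-- `Fil^•(B ⊗_{F,τ} E)` is decreasing. [cite: FontaineAsterisque223III, Exp. III §1.5.4] -/
theorem twistFil_antitone {i j : ℤ} (hij : i ≤ j) :
    LinearMap.range ((𝔅.fil j).subtype.rTensor (TwistCoeff τ)) ≤
      LinearMap.range ((𝔅.fil i).subtype.rTensor (TwistCoeff τ)) := fun _ hx =>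
  𝔅.twistFil_induction τ (C := fun x => x ∈ LinearMap.range ((𝔅.fil i).subtype.rTensor (TwistCoeff τ)))
    (zero_mem _) (fun _ hb e => 𝔅.tmul_mem_twistFil τ (𝔅.fil_antitone hij hb) e)
    (fun _ _ hx hy => add_mem hx hy) hx

/-- **`Fil^•(B ⊗_{F,τ} E)` is multiplicative**: `Fil^i · Fil^j ⊆ Fil^{i+j}`.
[cite: FontaineAsterisque223III, Exp. III §1.5.4 (the filtration of B is multiplicative)] -/
theorem mul_mem_twistFil {i j : ℤ} {x y : 𝔅.TwistRing τ}
    (hx : x ∈ LinearMap.range ((𝔅.fil i).subtype.rTensor (TwistCoeff τ)))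
    (hy : y ∈ LinearMap.range ((𝔅.fil j).subtype.rTensor (TwistCoeff τ))) :
    x * y ∈ LinearMap.range ((𝔅.fil (i + j)).subtype.rTensor (TwistCoeff τ)) := by
  refine 𝔅.twistFil_induction τ
    (C := fun x => x * y ∈ LinearMap.range ((𝔅.fil (i + j)).subtype.rTensor (TwistCoeff τ)))
    (by rw [zero_mul]; exact zero_mem _) (fun b hb e => ?_)
    (fun x x' hx hx' => by rw [add_mul]; exact add_mem hx hx') hx
  refine 𝔅.twistFil_induction τ
    (C := fun y => b ⊗ₜ[F] e * y ∈ LinearMap.range ((𝔅.fil (i + j)).subtype.rTensor (TwistCoeff τ)))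
    (by rw [mul_zero]; exact zero_mem _) (fun b' hb' e' => ?_)
    (fun y y' hy hy' => by rw [mul_add]; exact add_mem hy hy') hy
  rw [Algebra.TensorProduct.tmul_mul_tmul]
  exact 𝔅.tmul_mem_twistFil τ (𝔅.mul_mem_fil i j b b' hb hb') _

/-- `1 ∈ Fil⁰(B ⊗_{F,τ} E)`. [cite: FontaineAsterisque223III, Exp. III §1.5.4] -/
theorem one_mem_twistFil_zero :
    (1 : 𝔅.TwistRing τ) ∈ LinearMap.range ((𝔅.fil 0).subtype.rTensor (TwistCoeff τ)) :=
  𝔅.tmul_mem_twistFil τ 𝔅.one_mem_fil_zero 1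

/-- `(1 ⊗ e) · Fil^i ⊆ Fil^i`. [cite: FontaineAsterisque223III, Exp. III §1.5.4] -/
theorem twistScalar_mul_mem_twistFil (e : E) {i : ℤ} {x : 𝔅.TwistRing τ}
    (hx : x ∈ LinearMap.range ((𝔅.fil i).subtype.rTensor (TwistCoeff τ))) :
    𝔅.twistScalar τ e * x ∈ LinearMap.range ((𝔅.fil i).subtype.rTensor (TwistCoeff τ)) := by
  have h := 𝔅.mul_mem_twistFil τ (𝔅.tmul_mem_twistFil τ 𝔅.one_mem_fil_zero (TwistCoeff.toTwist τ e)) hx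
  rwa [zero_add] at h

/-- `(b ⊗ 1) · (1 ⊗ e) = b ⊗ e`: the scalar `algebraMap B (B ⊗_{F,τ} E) b · twistScalar e` lies in
`Fil^i` for `b ∈ Fil^i B`. [cite: Lang1965Algebra, Ch. XVI §6 (tensor product of algebras)] -/
theorem algebraMap_mul_twistScalar_mem_twistFil {i : ℤ} {b : 𝔅.B} (hb : b ∈ 𝔅.fil i) (e : E) :
    algebraMap 𝔅.B (𝔅.TwistRing τ) b * 𝔅.twistScalar τ e ∈
      LinearMap.range ((𝔅.fil i).subtype.rTensor (TwistCoeff τ)) := by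
  rw [Algebra.TensorProduct.algebraMap_apply, Algebra.algebraMap_self, RingHom.id_apply, twistScalar,
    Algebra.TensorProduct.tmul_mul_tmul, one_mul, mul_one]
  exact 𝔅.tmul_mem_twistFil τ hb _

/-- A product of elements of `Fil^{i_l}` lies in `Fil^{Σ i_l}`. [cite: FontaineAsterisque223III, Exp. III §1.5.4] -/
theorem prod_mem_twistFil {ι : Type*} (s : Finset ι) (x : ι → 𝔅.TwistRing τ) (i : ι → ℤ)
    (h : ∀ l ∈ s, x l ∈ LinearMap.range ((𝔅.fil (i l)).subtype.rTensor (TwistCoeff τ))) :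
    ∏ l ∈ s, x l ∈ LinearMap.range ((𝔅.fil (∑ l ∈ s, i l)).subtype.rTensor (TwistCoeff τ)) := by
  classical
  induction s using Finset.induction_on with
  | empty => rw [Finset.prod_empty, Finset.sum_empty]; exact 𝔅.one_mem_twistFil_zero τ
  | insert a s ha ih =>
    rw [Finset.prod_insert ha, Finset.sum_insert ha]
    exact 𝔅.mul_mem_twistFil τ (h a (Finset.mem_insert_self a s))
      (ih fun l hl => h l (Finset.mem_insert_of_mem hl))

/-- **A determinant whose `l`-th column lies in `Fil^{i_l}` lies in `Fil^{Σ_l i_l}`** (Leibniz formula).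
[cite: Lang1965Algebra, Ch. XIII §4 (expansion of the determinant)] -/
theorem det_mem_twistFil {m : ℕ} (A : Matrix (Fin m) (Fin m) (𝔅.TwistRing τ)) (i : Fin m → ℤ)
    (hA : ∀ k l, A k l ∈ LinearMap.range ((𝔅.fil (i l)).subtype.rTensor (TwistCoeff τ))) :
    A.det ∈ LinearMap.range ((𝔅.fil (∑ l, i l)).subtype.rTensor (TwistCoeff τ)) := by
  rw [Matrix.det_apply]
  refine Submodule.sum_mem _ fun σ _ => ?_
  rw [Units.smul_def]
  exact zsmul_mem (𝔅.prod_mem_twistFil τ Finset.univ (fun l => A (σ l) l) i fun l _ => hA (σ l) l) _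

/-- **`1 ∉ Fil¹(B ⊗_{F,τ} E)`**: in the `B`-basis `(1 ⊗ β_i)` of `B ⊗_F E` (`β` an `F`-basis of `E`)
every element of `Fil¹ B ⊗ E` has all coordinates in `Fil¹ B`, while `1 = 1 ⊗ 1` has a coordinate in
`F× ⊆ B`, and `F ∩ Fil¹ B = 0` (accepted `TateGraded.eq_zero_of_algebraMap_mem_fil_one`).
[cite: FontaineAsterisque223III, Exp. II §1.5.5 and Exp. III §1.5.4] [cite: Lang1965Algebra, Ch. XVI §2 (bases of A ⊗ M)] -/
theorem one_not_mem_twistFil_one :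
    (1 : 𝔅.TwistRing τ) ∉ LinearMap.range ((𝔅.fil 1).subtype.rTensor (TwistCoeff τ)) := by
  classical
  let β := Module.Basis.ofVectorSpace F (TwistCoeff τ)
  let 𝒷 := Algebra.TensorProduct.basis 𝔅.B β
  have hcoord : ∀ x ∈ LinearMap.range ((𝔅.fil 1).subtype.rTensor (TwistCoeff τ)), ∀ i, 𝒷.repr x i ∈ 𝔅.fil 1 := by
    intro x hx
    refine 𝔅.twistFil_induction τ (C := fun x => ∀ i, 𝒷.repr x i ∈ 𝔅.fil 1) (fun i => ?_)
      (fun b hb e i => ?_) (fun x y hx hy i => ?_) hx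
    · rw [map_zero, Finsupp.zero_apply]; exact zero_mem _
    · rw [Algebra.TensorProduct.basis_repr_tmul, Finsupp.smul_apply, Finsupp.mapRange_apply, smul_eq_mul,
        mul_comm, ← Algebra.smul_def]
      exact (𝔅.fil 1).smul_mem _ hb
    · rw [map_add, Finsupp.add_apply]; exact add_mem (hx i) (hy i)
  intro h1
  obtain ⟨i, hi⟩ : ∃ i, β.repr 1 i ≠ 0 := by
    by_contra h
    push Not at h
    have h0 : β.repr (1 : TwistCoeff τ) = 0 := Finsupp.ext h
    exact one_ne_zero (β.repr.injective (by rw [h0, map_zero]) : (1 : TwistCoeff τ) = 0)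
  have hmem : algebraMap F 𝔅.B (β.repr 1 i) ∈ 𝔅.fil 1 := by
    have h := hcoord 1 h1 i
    rwa [Algebra.TensorProduct.one_def, Algebra.TensorProduct.basis_repr_tmul, Finsupp.smul_apply,
      Finsupp.mapRange_apply, smul_eq_mul, one_mul] at h
  exact hi (PAdicHodge.TateGraded.eq_zero_of_algebraMap_mem_fil_one 𝔅 hmem)

/-- **`piTwist τ` maps `Eⁿ ⊗ Fil^j B` into `(Fil^j(B ⊗_{F,τ} E))ⁿ`.** [cite: FontaineAsterisque223III, Exp. III §1.5.4] -/
theorem piTwist_apply_mem_twistFil {n : ℕ} {j : ℤ} {x : (Fin n → E) ⊗[P] 𝔅.B}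
    (hx : x ∈ 𝔅.coeffFilTensor E (Fin n → E) j) (i : Fin n) :
    𝔅.piTwist τ n x i ∈ LinearMap.range ((𝔅.fil j).subtype.rTensor (TwistCoeff τ)) := by
  refine 𝔅.coeffFilTensor_induction (E := E) (M := Fin n → E)
    (C := fun x => 𝔅.piTwist τ n x i ∈ LinearMap.range ((𝔅.fil j).subtype.rTensor (TwistCoeff τ)))
    ?_ (fun v b hb => ?_) (fun y z hy hz => ?_) hx
  · rw [map_zero, Pi.zero_apply]; exact zero_mem _
  · rw [piTwist_tmul]; exact 𝔅.tmul_mem_twistFil τ hb _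
  · rw [map_add, Pi.add_apply]; exact add_mem hy hz

end TwistFil

/-! ### The dictionary `M ⊗ Fil^i B ↔ Fil^i B ⊗ M` -/

section Comm

variable {Γ : Type u} [Group Γ] {P : Type v} {F : Type v'} [Field P] [Field F] [Algebra P F]
  {E : Type*} [Field E] [Algebra P E]
  {M : Type*} [AddCommGroup M] [Module E M] [Module P M] [IsScalarTower P E M]
  (𝔅 : PeriodRingData.{u, v, v', w'} Γ P F)

/-- `x ∈ M ⊗ Fil^i B ⇒ comm x ∈ Fil^i B ⊗ M` (accepted `coeffFilTensor`, `filTensor`).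
[cite: FontaineAsterisque223III, Exp. III §1.5.4] -/
theorem comm_mem_filTensor_of_mem_coeffFilTensor {i : ℤ} {x : M ⊗[P] 𝔅.B}
    (hx : x ∈ 𝔅.coeffFilTensor E M i) : TensorProduct.comm P M 𝔅.B x ∈ 𝔅.filTensor M i := by
  refine 𝔅.coeffFilTensor_induction (E := E) (M := M)
    (C := fun x => TensorProduct.comm P M 𝔅.B x ∈ 𝔅.filTensor M i) ?_ (fun m b hb => ?_)
    (fun y z hy hz => ?_) hx
  · rw [map_zero]; exact zero_mem _
  · rw [TensorProduct.comm_tmul]; exact ⟨⟨b, hb⟩ ⊗ₜ[P] m, rfl⟩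
  · rw [map_add]; exact add_mem hy hz

/-- `y ∈ Fil^i B ⊗ M ⇒ comm⁻¹ y ∈ M ⊗ Fil^i B`. [cite: FontaineAsterisque223III, Exp. III §1.5.4] -/
theorem comm_symm_mem_coeffFilTensor_of_mem_filTensor {i : ℤ} {y : 𝔅.B ⊗[P] M}
    (hy : y ∈ 𝔅.filTensor M i) : (TensorProduct.comm P M 𝔅.B).symm y ∈ 𝔅.coeffFilTensor E M i := by
  obtain ⟨t, rfl⟩ := hy
  induction t using TensorProduct.induction_on with
  | zero => rw [map_zero, map_zero]; exact zero_mem _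
  | tmul b m =>
    rw [TensorProduct.AlgebraTensorModule.map_tmul, Submodule.subtype_apply, LinearMap.id_apply,
      TensorProduct.comm_symm_tmul]
    exact 𝔅.tmul_mem_coeffFilTensor _ b.2
  | add s t hs ht => rw [map_add, map_add]; exact add_mem hs ht

end Comm

/-! ### Labelled filtered generation and the labelled period determinant -/

section Generation

variable {Γ : Type u} [Group Γ] [TopologicalSpace Γ] {P : Type v} {F : Type v'} [Field P] [Field F]
  [Algebra P F] [TopologicalSpace P] {E : Type w} [Field E] [Algebra P E] [TopologicalSpace E]
  (𝔅 : PeriodRingData.{u, v, v', w'} Γ P F) (τ : F →ₐ[P] E) {n : ℕ}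
  (ρ : ContinuousRep Γ E (Fin n → E))

/-- **Labelled filtered generation.**  Under the filtered comparison for the underlying `P`-linear
representation (hypothesis `hcomp`: a `B`-basis of `B ⊗_P Eⁿ` inside `D_B` with weights `w_l` computing
`Fil^•(B ⊗ Eⁿ)` coordinatewise — accepted `TateGraded.exists_basis_mem_filTensor_iff` /
`exists_basis_mem_filTensor_iff_of_isDeRham`), with `E` containing the `[F:P]` embeddings of `F` and
`(d_k)` an `E`-basis of `D_τ(ρ)` adapted to the Hodge filtration (weights `h_k`): every
`x ∈ Eⁿ ⊗ Fil^j B` has **`piTwist τ x = Σ_k A_k · piTwist τ d_k` with `A_k ∈ Fil^{j − h_k}(B ⊗_{F,τ} E)`**.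
[cite: Patrikis2019, §2.3.1] [cite: Wach1996, §B.2.3, proof of Prop. 2 (p. 394)] [cite: FontaineAsterisque223III, Exp. III Thm. 1.5.2] -/
theorem piTwist_eq_sum_smul_of_mem_coeffFilTensor [FiniteDimensional P F] [Algebra.IsSeparable P F]
    (hsplit : Fintype.card (F →ₐ[P] E) = Module.finrank P F)
    (hcomp : ∃ (ℓ : ℕ) (𝒷 : Module.Basis (Fin ℓ) 𝔅.B (𝔅.B ⊗[P] (Fin n → E))) (w : Fin ℓ → ℤ),
      (∀ l, 𝒷 l ∈ 𝔅.D (ρ.restrictScalars P)) ∧ (∀ l, 𝒷 l ∈ 𝔅.filTensor (Fin n → E) (w l)) ∧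
      ∀ (j : ℤ) (y : 𝔅.B ⊗[P] (Fin n → E)),
        y ∈ 𝔅.filTensor (Fin n → E) j ↔ ∀ l, 𝒷.repr y l ∈ 𝔅.fil (j - w l))
    {m : ℕ} (d : Module.Basis (Fin m) E (𝔅.labelD ρ τ.toRingHom)) (h : Fin m → ℤ)
    (hiff : ∀ (i : ℤ) (v : 𝔅.labelD ρ τ.toRingHom),
      (v : (Fin n → E) ⊗[P] 𝔅.B) ∈ 𝔅.labelFilD ρ τ.toRingHom i ↔ ∀ k, d.repr v k ≠ 0 → i ≤ h k)
    {j : ℤ} {x : (Fin n → E) ⊗[P] 𝔅.B} (hx : x ∈ 𝔅.coeffFilTensor E (Fin n → E) j) :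
    ∃ A : Fin m → 𝔅.TwistRing τ,
      (∀ k, A k ∈ LinearMap.range ((𝔅.fil (j - h k)).subtype.rTensor (TwistCoeff τ))) ∧
      𝔅.piTwist τ n x = ∑ k, A k • 𝔅.piTwist τ n (d k : (Fin n → E) ⊗[P] 𝔅.B) := by
  classical
  obtain ⟨ℓ, 𝒷, w, h𝒷D, h𝒷w, hcrit⟩ := hcomp
  set y := TensorProduct.comm P (Fin n → E) 𝔅.B x with hy
  have hc : ∀ l, 𝒷.repr y l ∈ 𝔅.fil (j - w l) :=
    (hcrit j y).1 (𝔅.comm_mem_filTensor_of_mem_coeffFilTensor hx)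
  -- the comparison basis, moved to the coefficient side
  set u : Fin ℓ → (Fin n → E) ⊗[P] 𝔅.B := fun l => (TensorProduct.comm P (Fin n → E) 𝔅.B).symm (𝒷 l)
    with hu
  have huD : ∀ l, u l ∈ 𝔅.coeffD ρ := fun l => by
    rw [mem_coeffD_iff_comm_mem_D, hu]
    simp only [LinearEquiv.apply_symm_apply]
    exact h𝒷D l
  have huF : ∀ l, u l ∈ 𝔅.coeffFilTensor E (Fin n → E) (w l) := fun l =>
    𝔅.comm_symm_mem_coeffFilTensor_of_mem_filTensor (h𝒷w l)
  -- split each `u l` along the labels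
  choose z hz hzsum using fun l => 𝔅.exists_sum_labelFilD_eq ρ hsplit (huD l) (huF l)
  have hzD : ∀ l τ', z l τ' ∈ 𝔅.labelD ρ τ'.toRingHom := fun l τ' => (Submodule.mem_inf.1 (hz l τ')).1
  -- coordinates of the `τ`-components in the adapted basis
  set e : Fin ℓ → Fin m → E := fun l k => d.repr ⟨z l τ, hzD l τ⟩ k with he
  have hew : ∀ l k, e l k ≠ 0 → w l ≤ h k := fun l k => (hiff (w l) ⟨z l τ, hzD l τ⟩).1 (hz l τ) k
  have hzeq : ∀ l, z l τ = ∑ k, e l k • (d k : (Fin n → E) ⊗[P] 𝔅.B) := fun l => by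
    have h1 := congrArg Subtype.val (d.sum_repr ⟨z l τ, hzD l τ⟩)
    rw [Submodule.coe_sum] at h1
    exact h1.symm
  have hπu : ∀ l, 𝔅.piTwist τ n (u l) =
      ∑ k, 𝔅.twistScalar τ (e l k) • 𝔅.piTwist τ n (d k : (Fin n → E) ⊗[P] 𝔅.B) := fun l => by
    rw [← hzsum l, map_sum, Finset.sum_eq_single τ (fun τ' _ hne =>
      𝔅.piTwist_eq_zero_of_mem_labelD ρ τ hne (hzD l τ')) (fun h => absurd (Finset.mem_univ τ) h),
      hzeq l, map_sum]
    exact Finset.sum_congr rfl fun k _ => by rw [piTwist_smul]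
  refine ⟨fun k => ∑ l, algebraMap 𝔅.B (𝔅.TwistRing τ) (𝒷.repr y l) * 𝔅.twistScalar τ (e l k),
    fun k => ?_, ?_⟩
  · refine Submodule.sum_mem _ fun l _ => ?_
    by_cases hlk : e l k = 0
    · rw [hlk, ← twistScalarHom_apply, map_zero, mul_zero]; exact zero_mem _
    · have hwl := hew l k hlk
      exact 𝔅.algebraMap_mul_twistScalar_mem_twistFil τ (𝔅.fil_antitone (by omega) (hc l)) _
  · have hx' : x = ∑ l, 𝔅.baseActB E (Fin n → E) (𝒷.repr y l) (u l) := by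
      calc x = (TensorProduct.comm P (Fin n → E) 𝔅.B).symm y := by
            rw [hy, LinearEquiv.symm_apply_apply]
        _ = (TensorProduct.comm P (Fin n → E) 𝔅.B).symm (∑ l, 𝒷.repr y l • 𝒷 l) := by rw [𝒷.sum_repr]
        _ = ∑ l, 𝔅.baseActB E (Fin n → E) (𝒷.repr y l) (u l) := by
            rw [map_sum]
            exact Finset.sum_congr rfl fun l _ => 𝔅.comm_symm_smul E (Fin n → E) (𝒷.repr y l) (𝒷 l)
    have step : ∀ l, 𝔅.piTwist τ n (𝔅.baseActB E (Fin n → E) (𝒷.repr y l) (u l)) =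
        ∑ k, (algebraMap 𝔅.B (𝔅.TwistRing τ) (𝒷.repr y l) * 𝔅.twistScalar τ (e l k)) •
          𝔅.piTwist τ n (d k : (Fin n → E) ⊗[P] 𝔅.B) := fun l => by
      rw [piTwist_baseActB, hπu l, Finset.smul_sum]
      refine Finset.sum_congr rfl fun k _ => ?_
      rw [← algebraMap_smul (𝔅.TwistRing τ) (𝒷.repr y l), smul_smul]
    rw [hx', map_sum, Finset.sum_congr rfl fun l _ => step l, Finset.sum_comm]
    exact Finset.sum_congr rfl fun k _ => by rw [Finset.sum_smul]

/-- **The labelled period determinant is a unit of `B ⊗_{F,τ} E` of exact filtration degree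
`h = Σ_k h_k`.**  Same hypotheses, with the adapted basis `(d_k)_{k<n}` of `D_τ(ρ)` having `n` members
and `d_k ∈ Fil^{h_k} D_τ(ρ)`; `C = (piTwist τ d_k)_{k}` is the `n × n` matrix of their coordinates.
Then `det C` is a unit, `det C ∈ Fil^h(B ⊗_{F,τ} E)` and `det C ∉ Fil^{h+1}(B ⊗_{F,τ} E)`.
[cite: Patrikis2019, §2.3.1] [cite: Wach1996, §B.2.3, proof of Prop. 2 (p. 394)] [cite: FontaineAsterisque223III, Exp. III Thm. 1.5.2 and Prop. 1.5.2] -/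
theorem isUnit_det_piTwist_and_mem [FiniteDimensional P F] [Algebra.IsSeparable P F]
    (hsplit : Fintype.card (F →ₐ[P] E) = Module.finrank P F)
    (hcomp : ∃ (ℓ : ℕ) (𝒷 : Module.Basis (Fin ℓ) 𝔅.B (𝔅.B ⊗[P] (Fin n → E))) (w : Fin ℓ → ℤ),
      (∀ l, 𝒷 l ∈ 𝔅.D (ρ.restrictScalars P)) ∧ (∀ l, 𝒷 l ∈ 𝔅.filTensor (Fin n → E) (w l)) ∧
      ∀ (j : ℤ) (y : 𝔅.B ⊗[P] (Fin n → E)),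
        y ∈ 𝔅.filTensor (Fin n → E) j ↔ ∀ l, 𝒷.repr y l ∈ 𝔅.fil (j - w l))
    (d : Module.Basis (Fin n) E (𝔅.labelD ρ τ.toRingHom)) (h : Fin n → ℤ)
    (hdh : ∀ k, (d k : (Fin n → E) ⊗[P] 𝔅.B) ∈ 𝔅.labelFilD ρ τ.toRingHom (h k))
    (hiff : ∀ (i : ℤ) (v : 𝔅.labelD ρ τ.toRingHom),
      (v : (Fin n → E) ⊗[P] 𝔅.B) ∈ 𝔅.labelFilD ρ τ.toRingHom i ↔ ∀ k, d.repr v k ≠ 0 → i ≤ h k) :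
    IsUnit (Matrix.of fun k i => 𝔅.piTwist τ n (d k : (Fin n → E) ⊗[P] 𝔅.B) i).det ∧
      (Matrix.of fun k i => 𝔅.piTwist τ n (d k : (Fin n → E) ⊗[P] 𝔅.B) i).det ∈
        LinearMap.range ((𝔅.fil (∑ k, h k)).subtype.rTensor (TwistCoeff τ)) ∧
      (Matrix.of fun k i => 𝔅.piTwist τ n (d k : (Fin n → E) ⊗[P] 𝔅.B) i).det ∉
        LinearMap.range ((𝔅.fil (∑ k, h k + 1)).subtype.rTensor (TwistCoeff τ)) := by
  classical
  set C : Matrix (Fin n) (Fin n) (𝔅.TwistRing τ) :=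
    Matrix.of fun k i => 𝔅.piTwist τ n (d k : (Fin n → E) ⊗[P] 𝔅.B) i with hC
  -- the standard vectors `e_i ⊗ 1 ∈ Eⁿ ⊗ Fil⁰ B`
  have hstd : ∀ i : Fin n, (Pi.single i (1 : E)) ⊗ₜ[P] (1 : 𝔅.B) ∈ 𝔅.coeffFilTensor E (Fin n → E) 0 :=
    fun i => 𝔅.tmul_mem_coeffFilTensor _ 𝔅.one_mem_fil_zero
  choose A hA hAeq using fun i : Fin n =>
    𝔅.piTwist_eq_sum_smul_of_mem_coeffFilTensor τ ρ hsplit hcomp d h hiff (hstd i)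
  -- `A C = 1`
  have hAC : Matrix.of A * C = 1 := by
    ext i i'
    have h1 := congrFun (hAeq i) i'
    rw [piTwist_single_tmul_one, Finset.sum_apply, Pi.single_apply] at h1
    simp only [Pi.smul_apply, smul_eq_mul] at h1
    simp only [Matrix.mul_apply, Matrix.of_apply, Matrix.one_apply, hC]
    rw [← h1]
    by_cases hii : i = i'
    · subst hii; simp
    · simp [hii, Ne.symm hii]
  have hdet : (Matrix.of A).det * C.det = 1 := by rw [← Matrix.det_mul, hAC, Matrix.det_one]
  -- filtration degrees
  have hAmem : (Matrix.of A).det ∈ LinearMap.range ((𝔅.fil (-∑ k, h k)).subtype.rTensor (TwistCoeff τ)) := by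
    have h1 := 𝔅.det_mem_twistFil τ (Matrix.of A) (fun k => 0 - h k) fun i k => by
      rw [Matrix.of_apply]; exact hA i k
    have hidx : ∑ l : Fin n, (0 - h l) = -∑ k, h k := by
      simp only [zero_sub, Finset.sum_neg_distrib]
    rwa [hidx] at h1
  have hCmem : C.det ∈ LinearMap.range ((𝔅.fil (∑ k, h k)).subtype.rTensor (TwistCoeff τ)) := by
    rw [← Matrix.det_transpose]
    exact 𝔅.det_mem_twistFil τ C.transpose h fun i k => by
      rw [Matrix.transpose_apply, hC, Matrix.of_apply]
      exact 𝔅.piTwist_apply_mem_twistFil τ (Submodule.mem_inf.1 (hdh k)).2 i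
  refine ⟨isUnit_iff_exists_inv.2 ⟨_, by rw [mul_comm]; exact hdet⟩, hCmem, fun hmem => ?_⟩
  have h1 := 𝔅.mul_mem_twistFil τ hAmem hmem
  rw [hdet, show -∑ k, h k + (∑ k, h k + 1) = 1 by ring] at h1
  exact 𝔅.one_not_mem_twistFil_one τ h1

end Generation

end PeriodRingData

end Literature.NumberTheory.GaloisRepresentations

end
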